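import Literature.Barriers.FinalStateConjecture.ExtremalHorizonInstabilityLeaves
import Literature.Barriers.FinalStateConjecture.ExtremalHorizonBlowupProofs
import HarnessLib

/-!
# Barrier catalogue `FinalStateConjecture`: the narrowed Aretakis barrier from its analytic leaves
(`Literature/Barriers/FinalStateConjecture/`, D-0021, D-0014; family `gr`)

`ExtremalHorizonInstability.lean` carries, since the barrier audit of 2026-08-15, the narrowed
barrier `AretakisInstabilityNarrow`: conjunct (1) = `AretakisInstability` (the horizon instability
on EXTREMAL Kerr, Aretakis 2015, Thm. 3, existence form), conjunct (2) = the decay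
`(Yψ)² ≤ C τ^{-4+2δ}` of the SAME transversal derivative up to the horizon of every SUB-extremal
Kerr exterior for DRSR's admissible waves (Dafermos–Rodnianski–Shlapentokh-Rothman, Cor. 3.1
(31), through `(Yψ)² ≤ 2 ∑_μ (∂_μψ)²`, `Kerr.transversalDeriv_sq_le_two_mul_coordEnergyDensity`).
Meanwhile the library has reduced conjunct (1) further:

* `AretakisInstability.of_kerrSchild` (`ExtremalHorizonInstabilityLeaves.lean`):
  `KerrSchild.waveCauchyProblem → (Aretakis 2015, Thm. 3, clauses k = 1, 2, universal asymptotic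
  form) → AretakisInstability`;
* `Aretakis2015.scalarInstability_of_decay` (`ExtremalHorizonBlowupProofs.lean`):
  `Aretakis2012_pointwiseDecay → (Thm. 3)` — Thm. 3 being stated verbatim there and in
  `Aretakis2015.scalarInstability_of_facts` (until the review-split of 2026-08-15 it was the named
  fact `Aretakis2015_scalarInstability`, merged back under D-0026/D-0027); the conservation law of
  Prop. 5.1 (`Aretakis2015_chargeConservation_holds`), the projection to the zeroth azimuthal
  frequency and the `k = 2` blow-up mechanism of Thm. 2 being PROVED there.

This file records the two composites in one place, both **proved** and introducing no definition
and no named fact (D-0026):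

* `AretakisInstability.of_twoLeaves :
    KerrSchild.waveCauchyProblem → Aretakis2012_pointwiseDecay → AretakisInstability`;
* `AretakisInstabilityNarrow.of_leafFacts :
    KerrSchild.waveCauchyProblem → Aretakis2012_pointwiseDecay →
      drsr_wave_derivative_decay_kerr → (1) ∧ (2)`,

so that the trust base of the narrowed barrier is exactly the three single published results

1. `Literature.Geometry.Lorentzian.KerrSchild.waveCauchyProblem` — the global Cauchy problem with
   domain of dependence for divergence-form wave operators of generalised Kerr–Schild metrics on `ℝ⁴`
   (Bär–Ginoux–Pfäffle 2007, Thm. 3.2.11; `KerrSchildWaveCauchyProblem.lean`);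
2. `Literature.Barriers.FinalStateConjecture.Aretakis2012_pointwiseDecay` — Aretakis, JFA 263 (2012),
   Thm. 5: `sup_{S_τ}|ψ| → 0` for axisymmetric solutions on extremal Kerr
   (`ExtremalHorizonAxisymmetricDecay.lean`);
3. `Literature.Geometry.Lorentzian.drsr_wave_derivative_decay_kerr` — Dafermos–Rodnianski–
   Shlapentokh-Rothman, Ann. of Math. 183 (2016), Cor. 3.1 (31): pointwise decay of first
   derivatives on sub-extremal Kerr (`KerrWaveDecay.lean`).

This is the printed proof of Thm. 3 — "Combining the methods of [aretakis2], the results of the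
present paper (note, in particular, that the condition (add) holds on extremal Kerr) and [aretakis3]
and by projecting to the zeroth azimuthal frequency" (Aretakis 2015, p. 12, the sentence before
Thm. 3) — with `[aretakis3]` = leaf 2 and "solutions to the wave equation" = leaf 1, joined to the
sub-extremal complement (31) of DRSR = leaf 3 ("in sharp contrast with the non-extremal case where
decay holds for all higher order derivatives of `ψ` along `𝓗⁺`", Aretakis 2015, p. 4). Nothing here
is new mathematics; what is deliberately NOT here is any discharge of the three leaves.

**Statement form (review-split of `AretakisInstabilityNarrow`, 2026-08-15).** The conclusions below
spell out the conjunction `(1) ∧ (2)` itself rather than naming the constant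
`AretakisInstabilityNarrow` of `ExtremalHorizonInstability.lean`: as a `def … : Prop` that constant
was a conjunction of two catalogued named facts and nothing else — a duplicate entry in the debt
census with no source of its own — and it is being merged back into them (same name, same BARRIER
block, same conclusion, but a THEOREM whose hypotheses are its trust base). The statements of this
file are literally the unfolded ones and elaborate identically before and after that merge.

## References

* S. Aretakis, *Horizon instability of extremal black holes*, Adv. Theor. Math. Phys. 19 (2015)
  507–530 (arXiv:1206.6598), p. 4, §5.2, Prop. 5.1 and Thm. 3 (p. 12) (key `Aretakis2015`).
* S. Aretakis, *Decay of axisymmetric solutions of the wave equation on extreme Kerr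
  backgrounds*, J. Funct. Anal. 263 (2012) 2770–2831, Thm. 5 (key `Aretakis2012`).
* M. Dafermos, I. Rodnianski, Y. Shlapentokh-Rothman, *Decay for solutions of the wave equation on
  Kerr exterior spacetimes III: the full subextremal case `|a| < M`*, Ann. of Math. 183 (2016)
  787–913, arXiv:1402.7034, Cor. 3.1 (31) (p. 14) (key `DafermosRodnianskiShlapentokhrothman2014`).
* C. Bär, N. Ginoux, F. Pfäffle, *Wave equations on Lorentzian manifolds and quantization*, EMS
  2007 (arXiv:0806.1036), Thm. 3.2.11 (key `BarGinouxPfaffle2007`).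
-/

namespace Literature.Barriers.FinalStateConjecture

open Literature.Geometry.Lorentzian

/-- **Reduction (proved): the Aretakis barrier from its two remaining analytic leaves.** On extremal
Kerr `a = M`, the existence of a smooth solution of `□_g ψ = 0` with localised data whose transversal
derivative `Yψ` does not decay along `𝓗⁺` and whose second transversal derivative grows linearly along
`𝓗⁺` (`AretakisInstability`, Aretakis, ATMP 19 (2015), Thm. 3, existence form) follows from (1) the
global Cauchy problem for divergence-form wave operators of generalised Kerr–Schild metrics on `ℝ⁴`
(`KerrSchild.waveCauchyProblem`) and (2) the pointwise decay of axisymmetric solutions on extremal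
Kerr (Aretakis, JFA 263 (2012), Thm. 5; `Aretakis2012_pointwiseDecay`): compose
`AretakisInstability.of_kerrSchild` with `Aretakis2015.scalarInstability_of_decay` (which proves the
`k = 2` blow-up clause from the decay fact, the conservation law and the second-order horizon
identity). [cite: Aretakis2015, Thm. 3 (p. 12) and §5.2] -/
theorem AretakisInstability.of_twoLeaves
    (hKS : Literature.Geometry.Lorentzian.KerrSchild.waveCauchyProblem)
    (hDec : Literature.Barriers.FinalStateConjecture.Aretakis2012_pointwiseDecay) :
    Literature.Barriers.FinalStateConjecture.AretakisInstability :=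
  AretakisInstability.of_kerrSchild hKS (Aretakis2015.scalarInstability_of_decay hDec)

/-- **Reduction (proved): the narrowed Aretakis barrier from its three analytic leaves.** The
conjunction — (1) the horizon instability on EXTREMAL Kerr (`AretakisInstability`) [Aretakis 2015,
Thm. 3], (2) the decay `(Yψ)² ≤ C τ^{-4+2δ}`, `τ ≥ 1`, of the same transversal derivative
`Y = ℓ♯ = ∂_r` at every point of the near-zone leaves `{t* = τ} ∩ {r > r₊} ∩ {‖y‖ ≤ R}` of every
SUB-extremal Kerr exterior, for DRSR's admissible waves [DRSR, Cor. 3.1 (31)] — follows from the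
Cauchy problem for Kerr–Schild wave operators (`KerrSchild.waveCauchyProblem`), the decay of
axisymmetric waves on extremal Kerr (`Aretakis2012_pointwiseDecay`) and DRSR's pointwise derivative
decay (`drsr_wave_derivative_decay_kerr`, `∑_μ (∂_μψ)² ≤ C τ^{-4+2δ}` on those leaves), the last step
being `(Yψ)² ≤ 2 ∑_μ (∂_μψ)²` (`Kerr.transversalDeriv_sq_le_two_mul_coordEnergyDensity`, constant
`2C`). These three named facts are the whole trust base of the narrowed barrier
`AretakisInstabilityNarrow` of `ExtremalHorizonInstability.lean`, whose conclusion is this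
conjunction verbatim. [cite: DafermosRodnianskiShlapentokhrothman2014, Cor. 3.1 (31)] -/
theorem AretakisInstabilityNarrow.of_leafFacts
    (hKS : Literature.Geometry.Lorentzian.KerrSchild.waveCauchyProblem)
    (hDec : Literature.Barriers.FinalStateConjecture.Aretakis2012_pointwiseDecay)
    (hDRSR : Literature.Geometry.Lorentzian.drsr_wave_derivative_decay_kerr) :
    Literature.Barriers.FinalStateConjecture.AretakisInstability ∧
      ∀ [Kerr.Facts] [Kerr.SliceFacts] (M a : ℝ), Kerr.IsSubextremal M a →
        ∀ ψ : Kerr.exterior M a → ℝ, IsAdmissibleKerrWave M a ψ → ∀ δ : ℝ, 0 < δ → ∀ R : ℝ,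
          ∃ C : ℝ, ∀ τ : ℝ, 1 ≤ τ → ∀ (y : E3) (hy : E4.ofTimeSpace τ y ∈ Kerr.exterior M a),
            ‖y‖ ≤ R →
              Kerr.transversalDeriv a (Kerr.rPlus M a) ψ ⟨E4.ofTimeSpace τ y, hy⟩ ^ 2 ≤
                C * τ ^ (-4 + 2 * δ) := by
  refine ⟨AretakisInstability.of_twoLeaves hKS hDec, ?_⟩
  intro _ _ M a hMa ψ hψ δ hδ R
  obtain ⟨C, hC⟩ := hDRSR M a hMa ψ hψ δ hδ R
  refine ⟨2 * C, fun τ hτ y hy hyR ↦ ?_⟩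
  have h := hC τ hτ y hy hyR
  calc Kerr.transversalDeriv a (Kerr.rPlus M a) ψ ⟨E4.ofTimeSpace τ y, hy⟩ ^ 2
      ≤ 2 * coordEnergyDensity (Kerr.exterior M a) ψ (E4.ofTimeSpace τ y) :=
        Kerr.transversalDeriv_sq_le_two_mul_coordEnergyDensity a (Kerr.rPlus M a) ψ
          ⟨E4.ofTimeSpace τ y, hy⟩
    _ ≤ 2 * (C * τ ^ (-4 + 2 * δ)) := by linarith
    _ = 2 * C * τ ^ (-4 + 2 * δ) := by ring

/-- Under the two extremal leaves alone, conjunct (1) of the narrowed barrier and hence the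
non-decay witness of `AretakisInstability.exists_nondecaying` are available, while conjunct (2)
needs exactly DRSR's estimate: given the two extremal leaves, the conjunction `(1) ∧ (2)` is
EQUIVALENT to its sub-extremal conjunct. (Bookkeeping of the trust base; both directions are
one-liners.) [folklore] -/
theorem AretakisInstabilityNarrow.iff_subextremal_of_twoLeaves
    (hKS : Literature.Geometry.Lorentzian.KerrSchild.waveCauchyProblem)
    (hDec : Literature.Barriers.FinalStateConjecture.Aretakis2012_pointwiseDecay) :
    (Literature.Barriers.FinalStateConjecture.AretakisInstability ∧
      ∀ [Kerr.Facts] [Kerr.SliceFacts] (M a : ℝ), Kerr.IsSubextremal M a →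
        ∀ ψ : Kerr.exterior M a → ℝ, IsAdmissibleKerrWave M a ψ → ∀ δ : ℝ, 0 < δ → ∀ R : ℝ,
          ∃ C : ℝ, ∀ τ : ℝ, 1 ≤ τ → ∀ (y : E3) (hy : E4.ofTimeSpace τ y ∈ Kerr.exterior M a),
            ‖y‖ ≤ R →
              Kerr.transversalDeriv a (Kerr.rPlus M a) ψ ⟨E4.ofTimeSpace τ y, hy⟩ ^ 2 ≤
                C * τ ^ (-4 + 2 * δ)) ↔
      ∀ [Kerr.Facts] [Kerr.SliceFacts] (M a : ℝ), Kerr.IsSubextremal M a →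
        ∀ ψ : Kerr.exterior M a → ℝ, IsAdmissibleKerrWave M a ψ → ∀ δ : ℝ, 0 < δ → ∀ R : ℝ,
          ∃ C : ℝ, ∀ τ : ℝ, 1 ≤ τ → ∀ (y : E3) (hy : E4.ofTimeSpace τ y ∈ Kerr.exterior M a),
            ‖y‖ ≤ R →
              Kerr.transversalDeriv a (Kerr.rPlus M a) ψ ⟨E4.ofTimeSpace τ y, hy⟩ ^ 2 ≤
                C * τ ^ (-4 + 2 * δ) :=
  ⟨fun h ↦ h.2, fun h ↦ ⟨AretakisInstability.of_twoLeaves hKS hDec, h⟩⟩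

end Literature.Barriers.FinalStateConjecture
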